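import Summits.CriticalPhenomena.CardyFormulaZ2.Theorems.CardyMagicRigidityNestingRigidityNeckNodeAnnuliT
import Summits.CriticalPhenomena.CardyFormulaZ2.Theorems.CardyMagicRigidityNestingRigidityNeckZ2SkeletonArms
import HarnessLib

/-!
# Crux `NestingRigidity`, line `pinch-resampling` (v4), stub S11: the arms of a necklace skeleton on `𝕋`

Crux `Summit.CriticalPhenomena.CardyFormulaZ2.Theses.CardyMagicRigidity.NestingRigidity` (stmt-CriticalPhenomena-4835),
line `pinch-resampling` v4, stub S11 `stub_neckHookupCoarseT : NeckHookupCoarseT`.  Worker W6c, wave 6: the site-`𝕋` twin of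
`…NeckZ2SkeletonArms` (worker W6a): the ARM side of the hypotheses of the glued bound `real_tFourArm_and_armsIn_le`
(`…NeckNodeReimerRegionT`) for a `TNecklace` with a compatible cell skeleton (`…NeckSkeletonCellsT`, `…NeckNodeAnnuliT`).
Lattice-free pieces are REUSED from the `ℤ²` file: `exists_half_injOn`, the slot radii `Necklace.armRIn R₀ K z = R₀ 2^{Kz}`,
`Necklace.armROut R₀ K z = R₀ 2^{K(z+1)} - 1`, `Necklace.armRIn_le`.

* §1 `TNecklace.exists_armCells`: representatives `a m` of the occupied cells and a half-size set `A` of cells on which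
  `m ↦ bigIdx (a m)` is injective (`TNecklace.bigIdx_spec`: a big cluster passes through at most two locales).
* §2 `TNecklace.tArmAnnulus_disjoint`, `TNecklace.arm_harm`, `TNecklace.arm_hdist` — the arm annuli
  `tAnn (triNodeCenter m) (armRIn z) (armROut z)`, the arm hypothesis and the pairwise hypothesis of the glue.
* §3 `TNecklace.arm_havoid` (registered anchor `tNecklace_arm_exemption`): exemption of arms from certified nodes.
-/

noncomputable section

namespace Summit.CriticalPhenomena.CardyFormulaZ2.Cruxes.NestingRigidity.PinchResampling

open MeasureTheory Set Literature.Probability.Percolation Literature.Probability.LatticeModels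
open Finset
open NeckCoarseZ2 (rotIdx CellSkeleton)

namespace TNecklace

variable {η : SiteConfig (Site 2)} {ℓ lam s : ℕ} {x : Site 2} (N : TNecklace η ℓ lam s x) {Nc : ℤ}
  (S : CellSkeleton Nc)

/-- **Arm cells and representatives**: for a cell skeleton compatible with the necklace there are representatives
`a m < k` of the rotated cells `t m` (`m < n`) and a set `A ⊆ [0, n)` of cells with `n ≤ 2 |A|` on which
`m ↦ bigIdx (a m)` is injective. -/
theorem exists_armCells
    (hcomp' : ∀ m < S.n, ∃ a < N.k, rotIdx Nc S.a₀ (NeckCoarse.triCellIdx ((s : ℤ) + 1) ℓ (N.p a - x)) = S.t m) :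
    ∃ (a : ℕ → ℕ) (A : Finset ℕ), (∀ m < S.n, a m < N.k ∧ rotIdx Nc S.a₀ (NeckCoarse.triCellIdx ((s : ℤ) + 1) ℓ (N.p (a m) - x)) = S.t m) ∧
      A ⊆ range S.n ∧ S.n ≤ 2 * A.card ∧ Set.InjOn (fun m ↦ N.bigIdx (a m)) ↑A := by
  classical
  choose! a ha hat using hcomp'
  -- distinct cells have distinct representatives
  have hainj : ∀ m < S.n, ∀ m' < S.n, a m = a m' → m = m' := fun m hm m' hm' h ↦ by
    have h1 := hat m hm
    rw [h, hat m' hm'] at h1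
    by_contra hne
    rcases lt_or_gt_of_ne hne with hlt | hlt
    · exact absurd (S.t_strictMono hlt hm') (by rw [h1]; exact lt_irrefl _)
    · exact absurd (S.t_strictMono hlt hm) (by rw [h1]; exact lt_irrefl _)
  obtain ⟨A, hA, hcard, hinj⟩ := exists_half_injOn (range S.n) (fun m ↦ N.bigIdx (a m))
    (fun m hm m' hm' m'' hm'' h h' ↦ by
      rw [Finset.mem_range] at hm hm' hm''
      -- three cells sharing a big cluster: impossible (`bigIdx b ∈ [b, b + 1]`)
      have s1 := N.bigIdx_spec (a m)
      have s2 := N.bigIdx_spec (a m')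
      have s3 := N.bigIdx_spec (a m'')
      by_cases e1 : a m = a m'
      · exact Or.inl (hainj _ hm _ hm' e1)
      by_cases e2 : a m' = a m''
      · exact Or.inr (Or.inl (hainj _ hm' _ hm'' e2))
      by_cases e3 : a m = a m''
      · exact Or.inr (Or.inr (hainj _ hm _ hm'' e3))
      exfalso
      omega)
  exact ⟨a, A, fun m hm ↦ ⟨ha m hm, hat m hm⟩, hA, by rwa [card_range] at hcard, hinj⟩

/-! ## §2 Arm annuli -/

omit N S in
/-- **Different slots of one centre have disjoint annuli.** -/
theorem tArmAnnulus_disjoint {R₀ K : ℕ} (hR₀ : 2 ≤ R₀) (w : Site 2) {z z' : ℕ} (hzz : z ≠ z') :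
    Disjoint (tAnn w (Necklace.armRIn R₀ K z) (Necklace.armROut R₀ K z)) (tAnn w (Necklace.armRIn R₀ K z') (Necklace.armROut R₀ K z')) := by
  -- the slot with the smaller index ends before the other begins
  wlog hlt : z < z' generalizing z z'
  · exact (this hzz.symm (lt_of_le_of_ne (not_lt.1 hlt) hzz.symm)).symm
  have hmono : Necklace.armROut R₀ K z < Necklace.armRIn R₀ K z' := by
    have h1 : 2 ^ (K * (z + 1)) ≤ 2 ^ (K * z') := Nat.pow_le_pow_right (by norm_num) (by nlinarith)
    have h2 : 1 ≤ R₀ * 2 ^ (K * (z + 1)) := by nlinarith [Nat.one_le_two_pow (n := K * (z + 1))]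
    have h3 : R₀ * 2 ^ (K * (z + 1)) ≤ R₀ * 2 ^ (K * z') := Nat.mul_le_mul_left _ h1
    simp only [Necklace.armRIn, Necklace.armROut]
    generalize R₀ * 2 ^ (K * (z + 1)) = P at h2 h3 ⊢
    generalize R₀ * 2 ^ (K * z') = Q at h3 ⊢
    omega
  rw [Set.disjoint_left]
  rintro y ⟨-, hy⟩ ⟨hy', -⟩
  have : (Necklace.armROut R₀ K z : ℤ) < Necklace.armRIn R₀ K z' := by exact_mod_cast hmono
  omega

/-- **The arm hypothesis `harm` of the glue**: the representative locale of the cell `m` (rotated cell `t m`) starts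
an arm across every slot around `nodeCenter m` with `ℓ ≤ R₀` and `2 · armROut ≤ lam`. -/
theorem arm_harm (hℓ : 1 ≤ ℓ) (hNc : 6 * ((s : ℤ) + 1) ≤ Nc * ℓ) (hNc' : (Nc - 1) * (ℓ : ℤ) < 6 * ((s : ℤ) + 1))
    {a m : ℕ} (ha : a < N.k) (hm : m < S.n)
    (hat : rotIdx Nc S.a₀ (NeckCoarse.triCellIdx ((s : ℤ) + 1) ℓ (N.p a - x)) = S.t m) {R₀ K z : ℕ} (hR₀ : ℓ ≤ R₀)
    (hlam : 2 * Necklace.armROut R₀ K z ≤ lam) :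
    triNorm (N.p a - S.triNodeCenter ((s : ℤ) + 1) ℓ x m) < Necklace.armRIn R₀ K z ∧
      ∃ q, (Necklace.armROut R₀ K z : ℤ) ≤ triNorm (q - S.triNodeCenter ((s : ℤ) + 1) ℓ x m) ∧
        PathIn (tColourGraph η true) (tBall x (2 * s)) (N.p a) q := by
  have hℓ0 : (0 : ℤ) < ℓ := by exact_mod_cast hℓ
  refine N.arm_hypothesis ha ?_ hlam
  have h := S.triNorm_sub_center_lt hℓ0 (by omega) hNc hNc' (N.triNorm_p_sub ha) le_rfl le_rfl hm hat
  simp only [sub_self, zero_add, one_mul] at h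
  simp only [CellSkeleton.triNodeCenter]
  rw [show N.p a - (x + NeckCoarse.triIdxPt ((s : ℤ) + 1) (ℓ : ℤ) Nc S.a₀ (S.t m)) =
    N.p a - x - NeckCoarse.triIdxPt ((s : ℤ) + 1) (ℓ : ℤ) Nc S.a₀ (S.t m) by abel]
  have h1 : (ℓ : ℤ) ≤ Necklace.armRIn R₀ K z := by
    have : R₀ ≤ Necklace.armRIn R₀ K z := by
      simp only [Necklace.armRIn]
      nlinarith [Nat.one_le_two_pow (n := K * z)]
    exact_mod_cast hR₀.trans this
  omega

/-- **The pairwise hypothesis `hdist` of the glue**: arms at two cells of `A` with distinct indices, or at one cell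
with distinct slots, start in distinct clusters inside `Λ_{2s}(x)` or have disjoint annuli. -/
theorem arm_hdist {a : ℕ → ℕ} {A : Finset ℕ} (haA : ∀ m ∈ A, a m < N.k)
    (hinj : Set.InjOn (fun m ↦ N.bigIdx (a m)) ↑A) {R₀ K : ℕ} (hR₀ : 2 ≤ R₀) {m z m' z' : ℕ}
    (hm : m ∈ A) (hm' : m' ∈ A) (hne : (m, z) ≠ (m', z')) :
    ¬ PathIn (tColourGraph η true) (tBall x (2 * s)) (N.p (a m)) (N.p (a m')) ∨
      Disjoint (tAnn (S.triNodeCenter ((s : ℤ) + 1) ℓ x m) (Necklace.armRIn R₀ K z) (Necklace.armROut R₀ K z))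
        (tAnn (S.triNodeCenter ((s : ℤ) + 1) ℓ x m') (Necklace.armRIn R₀ K z') (Necklace.armROut R₀ K z')) := by
  by_cases hmm : m = m'
  · subst hmm
    right
    exact tArmAnnulus_disjoint hR₀ _ fun h ↦ hne (by rw [h])
  · left
    exact N.not_path_p_p (haA m hm) (haA m' hm') fun h ↦ hmm (hinj hm hm' h)

/-! ## §3 Exemption from the nodes -/

/-- **The alternative `havoid` of the glue for one arm and one certified node**: if the big cluster of the arm's locale
is neither `u i₁` nor `u (j₁ + 1)` (the crossing clusters), the arm is cluster-exempt; otherwise (a CONFLICT) the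
claimed slot must be spatially disjoint from the node annulus, which is the hypothesis `hfree`. -/
theorem arm_havoid {a₁ : ℕ} (ha₁ : a₁ < N.k) {i₁ j₁ : ℕ} (hi₁ : i₁ ≤ N.k) (hj₁ : j₁ + 1 ≤ N.k) {p₁ p₂ : Site 2}
    (hp₁ : PathIn (tColourGraph η true) (tBall x (2 * s)) (N.u i₁) p₁)
    (hp₂ : PathIn (tColourGraph η true) (tBall x (2 * s)) (N.u (j₁ + 1)) p₂) {Arm Node : Set (Site 2)}
    (hfree : (N.bigIdx a₁ = i₁ ∨ N.bigIdx a₁ = j₁ + 1) → Disjoint Arm Node) :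
    (¬ PathIn (tColourGraph η true) (tBall x (2 * s)) (N.p a₁) p₁ ∧ ¬ PathIn (tColourGraph η true) (tBall x (2 * s)) (N.p a₁) p₂) ∨
      Disjoint Arm Node := by
  by_cases hc : N.bigIdx a₁ = i₁ ∨ N.bigIdx a₁ = j₁ + 1
  · exact Or.inr (hfree hc)
  · rw [not_or] at hc
    exact Or.inl (N.not_path_p_of_bigIdx_ne ha₁ hi₁ hj₁ hc.1 hc.2 hp₁ hp₂)

end TNecklace

/-- **Cluster exemption of arms from certified nodes (registered helper, anchor of this module on the crux item)**:
an arm started at a locale whose big cluster is neither crossing cluster `u i₁`, `u (j₁ + 1)` of a node certificate is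
joined inside `Λ_{2s}(x)` to neither crossing start; hence, if conflicts are resolved spatially (`hfree`), the
alternative `havoid` of `real_tFourArm_and_armsIn_le` holds (`TNecklace.arm_havoid`). -/
theorem tNecklace_arm_exemption : ∀ (ℓ lam s : ℕ) (x : Site 2) (η : SiteConfig (Site 2)) (N : TNecklace η ℓ lam s x) (a₁ i₁ j₁ : ℕ) (p₁ p₂ : Site 2) (Arm Node : Set (Site 2)), a₁ < N.k → i₁ ≤ N.k → j₁ + 1 ≤ N.k → PathIn (tColourGraph η true) (tBall x (2 * s)) (N.u i₁) p₁ → PathIn (tColourGraph η true) (tBall x (2 * s)) (N.u (j₁ + 1)) p₂ → ((N.bigIdx a₁ = i₁ ∨ N.bigIdx a₁ = j₁ + 1) → Disjoint Arm Node) → (¬ PathIn (tColourGraph η true) (tBall x (2 * s)) (N.p a₁) p₁ ∧ ¬ PathIn (tColourGraph η true) (tBall x (2 * s)) (N.p a₁) p₂) ∨ Disjoint Arm Node :=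
  fun _ _ _ _ _ N _ _ _ _ _ _ _ ha₁ hi₁ hj₁ hp₁ hp₂ hfree ↦ N.arm_havoid ha₁ hi₁ hj₁ hp₁ hp₂ hfree

end Summit.CriticalPhenomena.CardyFormulaZ2.Cruxes.NestingRigidity.PinchResampling

end
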